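import Mathlib

/-!
# Hodge-locus census — THEOREM SM-∞: the Σ-row KERNEL IDENTITY Σ_j ℓ_j h_j = q·g, cells (2k′, d, k′−1), k′ = 2, …, 7

certified instances and evidence bearing on the general Hodge conjecture; no claim.

ENGINE B gen 35 (record `ENGINEB-g35.md` §1.3).  For the Σ-row member `F_N = N·F₀ + F₁` the restricted part is `π(F_N) = (h ; g)` with
`h_j = N x_j^{d−1} + t_j`, `t_j = −x_{j+1}^{d−2} x_{j+2}` (`j ≤ k′−3`), `t_{k′−2} = −x_0 x_{k′−1}^{d−2}`, `t_{k′−1} = 0`, `g = x_0^{d−3} x_1`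
(`d = e + 3`).  The record's kernel vector `(q ; ℓ) = (N^{k′} x_0² ; N^{k′−1} x_1, N^{k′−2} x_2, …, N x_{k′−1}, x_0)` satisfies the EXACT identity
`Σ_j ℓ_j h_j = q·g` (consecutive couplings cancel and the loop-closing pair cancels — the telescoping of §1.3), i.e. `(q ; ℓ)` lies in the kernel
of `Φ_{π(F_N)}`; since the `k′` linear forms `ℓ_j` are linearly independent this exhibits a kernel element of rank `k′` (the Σ^{k′}-direction of
SM-∞'s membership clause; that the kernel is spanned by it, β = 1, is a Gröbner fact certified by two implementations, §1.6, not here).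
Below: the identity for `k′ = 2, …, 7` explicitly (`ring`) and UNIFORMLY in `k′ ≥ 2` (`sigma_kernel_identity`, `x : ℕ → R`, `t_j` / `ℓ_j` as
`if`-branches on the index, telescoping via `Finset.sum_range_sub'`), over an arbitrary commutative ring, symbolic in `N` and in `e ≥ 0`.
Plus the one-line kernel identities of the rows (P′) and (P).  Transcription check: `gen35/check_kernel_identity.py` (the `if`-branch `t_j`, `ℓ_j`,
`q`, `g` vs implementation B's `sminf_families.family('Sigma' | 'Qr:r' | 'Pprime' | 'P', k, d, N)` data at exact integer points; 0 mismatches).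
Def-free, Mathlib only.
-/

namespace Summit.HodgeConjecture.HodgeConjecture.HodgeLocus.Census.SigmaFamilyKernel

/-- Σ-row kernel identity, k′ = 2 (cell (4, e+3, 1)): `Σ_j ℓ_j h_j = (N^2 x_0²)·(x_0^e x_1)`. -/
theorem sigma_kernel_identity_k2 {R : Type*} [CommRing R] (N : R) (e : ℕ) (x0 x1 : R) :
    N * x1 * (N * x0 ^ (e + 2) - x0 * x1 ^ (e + 1)) + x0 * (N * x1 ^ (e + 2))
    = (N ^ 2 * x0 ^ 2) * (x0 ^ e * x1) := by
  ring

/-- Σ-row kernel identity, k′ = 3 (cell (6, e+3, 2)): `Σ_j ℓ_j h_j = (N^3 x_0²)·(x_0^e x_1)`. -/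
theorem sigma_kernel_identity_k3 {R : Type*} [CommRing R] (N : R) (e : ℕ) (x0 x1 x2 : R) :
    N ^ 2 * x1 * (N * x0 ^ (e + 2) - x1 ^ (e + 1) * x2) + N * x2 * (N * x1 ^ (e + 2) - x0 * x2 ^ (e + 1)) + x0 * (N * x2 ^ (e + 2))
    = (N ^ 3 * x0 ^ 2) * (x0 ^ e * x1) := by
  ring

/-- Σ-row kernel identity, k′ = 4 (cell (8, e+3, 3)): `Σ_j ℓ_j h_j = (N^4 x_0²)·(x_0^e x_1)`. -/
theorem sigma_kernel_identity_k4 {R : Type*} [CommRing R] (N : R) (e : ℕ) (x0 x1 x2 x3 : R) :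
    N ^ 3 * x1 * (N * x0 ^ (e + 2) - x1 ^ (e + 1) * x2) + N ^ 2 * x2 * (N * x1 ^ (e + 2) - x2 ^ (e + 1) * x3) + N * x3 * (N * x2 ^ (e + 2) - x0 * x3 ^ (e + 1)) + x0 * (N * x3 ^ (e + 2))
    = (N ^ 4 * x0 ^ 2) * (x0 ^ e * x1) := by
  ring

/-- Σ-row kernel identity, k′ = 5 (cell (10, e+3, 4)): `Σ_j ℓ_j h_j = (N^5 x_0²)·(x_0^e x_1)`. -/
theorem sigma_kernel_identity_k5 {R : Type*} [CommRing R] (N : R) (e : ℕ) (x0 x1 x2 x3 x4 : R) :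
    N ^ 4 * x1 * (N * x0 ^ (e + 2) - x1 ^ (e + 1) * x2) + N ^ 3 * x2 * (N * x1 ^ (e + 2) - x2 ^ (e + 1) * x3) + N ^ 2 * x3 * (N * x2 ^ (e + 2) - x3 ^ (e + 1) * x4) + N * x4 * (N * x3 ^ (e + 2) - x0 * x4 ^ (e + 1)) + x0 * (N * x4 ^ (e + 2))
    = (N ^ 5 * x0 ^ 2) * (x0 ^ e * x1) := by
  ring

/-- Σ-row kernel identity, k′ = 6 (cell (12, e+3, 5)): `Σ_j ℓ_j h_j = (N^6 x_0²)·(x_0^e x_1)`. -/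
theorem sigma_kernel_identity_k6 {R : Type*} [CommRing R] (N : R) (e : ℕ) (x0 x1 x2 x3 x4 x5 : R) :
    N ^ 5 * x1 * (N * x0 ^ (e + 2) - x1 ^ (e + 1) * x2) + N ^ 4 * x2 * (N * x1 ^ (e + 2) - x2 ^ (e + 1) * x3) + N ^ 3 * x3 * (N * x2 ^ (e + 2) - x3 ^ (e + 1) * x4) + N ^ 2 * x4 * (N * x3 ^ (e + 2) - x4 ^ (e + 1) * x5) + N * x5 * (N * x4 ^ (e + 2) - x0 * x5 ^ (e + 1)) + x0 * (N * x5 ^ (e + 2))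
    = (N ^ 6 * x0 ^ 2) * (x0 ^ e * x1) := by
  ring

/-- Σ-row kernel identity, k′ = 7 (cell (14, e+3, 6)): `Σ_j ℓ_j h_j = (N^7 x_0²)·(x_0^e x_1)`. -/
theorem sigma_kernel_identity_k7 {R : Type*} [CommRing R] (N : R) (e : ℕ) (x0 x1 x2 x3 x4 x5 x6 : R) :
    N ^ 6 * x1 * (N * x0 ^ (e + 2) - x1 ^ (e + 1) * x2) + N ^ 5 * x2 * (N * x1 ^ (e + 2) - x2 ^ (e + 1) * x3) + N ^ 4 * x3 * (N * x2 ^ (e + 2) - x3 ^ (e + 1) * x4) + N ^ 3 * x4 * (N * x3 ^ (e + 2) - x4 ^ (e + 1) * x5) + N ^ 2 * x5 * (N * x4 ^ (e + 2) - x5 ^ (e + 1) * x6) + N * x6 * (N * x5 ^ (e + 2) - x0 * x6 ^ (e + 1)) + x0 * (N * x6 ^ (e + 2))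
    = (N ^ 7 * x0 ^ 2) * (x0 ^ e * x1) := by
  ring

/-- Σ-row kernel identity, UNIFORM in k′ ≥ 2: with `ℓ_j = N^{k−1−j} x_{j+1}` (`j ≤ k−2`), `ℓ_{k−1} = x_0` and
`h_j = N x_j^{e+2} + t_j` (`t_j` by cases on the position of `j` in the cycle, as `if`-branches; only indices `< k` occur),
`Σ_{j<k} ℓ_j h_j = (N^k x_0²)·(x_0^e x_1)`.  Proof: the sum telescopes (`Finset.sum_range_sub'`). -/
theorem sigma_kernel_identity (k : ℕ) (hk : 2 ≤ k) {R : Type*} [CommRing R] (N : R) (e : ℕ) (x : ℕ → R) :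
    (Finset.range k).sum (fun j =>
      (if j + 1 < k then N ^ (k - 1 - j) * x (j + 1) else x 0) *
      (N * x j ^ (e + 2) +
        (if j + 3 ≤ k then -(x (j + 1) ^ (e + 1) * x (j + 2))
         else if j + 2 = k then -(x 0 * x (k - 1) ^ (e + 1)) else 0)))
    = (N ^ k * x 0 ^ 2) * (x 0 ^ e * x 1) := by
  obtain ⟨m, rfl⟩ : ∃ m, k = m + 2 := ⟨k - 2, by omega⟩
  -- A j = N^{k-j} x_{j+1} x_j^{e+2}; the summands j < m are A j − A (j+1), the last two close the loop
  set A : ℕ → R := fun j => N ^ (m + 2 - j) * x (j + 1) * x j ^ (e + 2) with hA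
  rw [Finset.sum_range_succ, Finset.sum_range_succ]
  have hmid : (Finset.range m).sum (fun j =>
      (if j + 1 < m + 2 then N ^ (m + 2 - 1 - j) * x (j + 1) else x 0) *
      (N * x j ^ (e + 2) +
        (if j + 3 ≤ m + 2 then -(x (j + 1) ^ (e + 1) * x (j + 2))
         else if j + 2 = m + 2 then -(x 0 * x (m + 2 - 1) ^ (e + 1)) else 0)))
      = (Finset.range m).sum (fun j => A j - A (j + 1)) := by
    refine Finset.sum_congr rfl (fun j hj => ?_)
    have hjm : j < m := Finset.mem_range.mp hj
    rw [if_pos (by omega), if_pos (by omega), hA]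
    simp only
    rw [show m + 2 - 1 - j = (m + 1 - j) by omega, show m + 2 - j = (m + 1 - j) + 1 by omega,
      show m + 2 - (j + 1) = m + 1 - j by omega]
    ring
  rw [hmid, Finset.sum_range_sub']
  have r1 : N ^ (m + 2 - 1 - m) = N := by rw [show m + 2 - 1 - m = 1 by omega, pow_one]
  have r2 : x (m + 2 - 1) = x (m + 1) := by rw [show m + 2 - 1 = m + 1 by omega]
  have r3 : A 0 = N ^ (m + 2) * x 1 * x 0 ^ (e + 2) := by simp only [hA, Nat.sub_zero, zero_add]
  have r4 : A m = N ^ 2 * x (m + 1) * x m ^ (e + 2) := by simp only [hA]; rw [show m + 2 - m = 2 by omega]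
  rw [r3, r4]
  split_ifs <;> first | omega | (rw [r1, r2]; ring)

/-- Row (P′) kernel identity: `h_0 = N x_0^{e+2} + x_0^{e} x_1²`, `g = x_0^{e+1}`, `(q ; ℓ) = (N x_0² + x_1² ; x_0, 0, …, 0)`:
`ℓ_0 h_0 = q·g`. -/
theorem pprime_kernel_identity {R : Type*} [CommRing R] (N : R) (e : ℕ) (x0 x1 : R) :
    x0 * (N * x0 ^ (e + 2) + x0 ^ e * x1 ^ 2) = (N * x0 ^ 2 + x1 ^ 2) * x0 ^ (e + 1) := by
  ring

/-- Row (P) kernel identity: `h_0 = N x_0^{e+2}`, `g = x_0^{e+1}`, `(q ; ℓ) = (N x_0 c ; c, 0, …, 0)` for any linear form `c`: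
`ℓ_0 h_0 = q·g`. -/
theorem p_kernel_identity {R : Type*} [CommRing R] (N : R) (e : ℕ) (x0 c : R) :
    c * (N * x0 ^ (e + 2)) = (N * x0 * c) * x0 ^ (e + 1) := by
  ring

end Summit.HodgeConjecture.HodgeConjecture.HodgeLocus.Census.SigmaFamilyKernel
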